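import Literature.AnabelianGeometry.EtaleTheta.ThetaFrobenioidOfTempered
import Literature.AnabelianGeometry.EtaleTheta.BiKummerOfModelCanonical

/-!
# [EtTh] §5 merge adapter III: the §5 Frobenioid-level stub of a §4 bi-Kummer setting

Mochizuki, *The étale theta function and its Frobenioid-theoretic manifestations*, Publ. RIMS **45**
(2009), §5 p. 322 (PDF p. 96) and Def. 4.1 (iv) p. 313 (PDF p. 87) [cite: MochizukiEtTh2009, §5 p.322
(PDF p.96)].  abc-iut cell, layer L2, unit W2-L2-05 (merge adapter t3/found/L1 → t4), seat abc-iut-L2-t9.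

`ThetaFrobenioidOfTempered.lean` instantiates abc-iut-L2-t4's §5 Frobenioid-level stub
`TemperedFrobenioidStub` for the category of a tempered Frobenioid `C₀` with every field REAL except the
class of morphisms "of base-Frobenius type" (Def. 4.1 (iv)), left as the parameter `IsBFT`.  abc-iut-L2-t3
types Def. 4.1 (iv) REALLY over a §4 setting `S : BiKummerSetting X T D VD` as
`S.IsOfBaseFrobeniusType` (`BiKummer.lean`); this file plugs it in:

* `BiKummerSetting.thetaStub S hΦ : TemperedFrobenioidStub S.C D` — the §5 Frobenioid-level vocabulary of the
  tempered Frobenioid of the setting, with `IsBaseFrobeniusType := S.IsOfBaseFrobeniusType` (Def. 4.1 (iv)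
  (a)–(e) as typed by abc-iut-L2-t3); only `hΦ` (`Φ(A)` integral) remains an input;
* for the CANONICAL model setting `mkOfModelCanonical` (`BiKummerOfModelCanonical.lean`) clause (e) of
  Def. 4.1 (iv) is `TemperedFrobenioid.ArisesFromBaseFrobeniusPair` ([FrdI] Def. 2.7 (iii) / Prop. 5.6) and
  clause (i)'s disjoint supports is [FrdI] Prop. 4.1 (iii) coprimality — so every field of the §5
  Frobenioid-level stub is now real over (abc-iut-L2-t3's §3 data, Galois data, `(N,H)`-saturation, `A_⊙`).

HONEST FRAMING: constructions over abc-iut-L2-t3's DATA structures; nothing asserts these data exist for an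
actual curve; no statement of §4–§5 is proved here; typed ≠ proved.
-/

noncomputable section

namespace Literature.AnabelianGeometry.EtaleTheta

namespace BiKummerSetting

open CategoryTheory Opposite Literature.AlgebraicGeometry.Frobenioids FrobenioidTheta

universe u₀ v₀ u v w

variable {K : Type u₀} [Field K] {X : SemiGraphs.TemperedArithmeticGroup.{u₀} K} {D₀ : Type u₀}
  [Category.{v₀} D₀] {V : FrdIMonoidStub.{w}} {T : RealifiedDivisorMonoids (D₀ := D₀) V}
  {D : Type u} [Category.{v} D] {VD : FrdICatStub.{u, v, w} D} (S : BiKummerSetting X T D VD)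

/-- Def. 4.1 (iv) as a class of morphisms of `C`: "of base-Frobenius type" (abc-iut-L2-t3's
`IsOfBaseFrobeniusType`, read as a `MorphismProperty`).
[cite: MochizukiEtTh2009, Def 4.1 p.313 (PDF p.87)] -/
def isOfBaseFrobeniusType : MorphismProperty S.C := fun _ _ α => S.IsOfBaseFrobeniusType α

/-- Membership: `isOfBaseFrobeniusType α ↔ IsOfBaseFrobeniusType α`.
[cite: MochizukiEtTh2009, Def 4.1 p.313 (PDF p.87)] -/
@[simp] theorem isOfBaseFrobeniusType_iff {A B : S.C} (α : A ⟶ B) :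
    S.isOfBaseFrobeniusType α ↔ S.IsOfBaseFrobeniusType α := Iff.rfl

/-- **The §5 Frobenioid-level stub of the tempered Frobenioid of a §4 setting** ("the tempered Frobenioid
`C` of monoid type `ℤ` over the base category `D`", §5 p.322 (PDF p.96)): abc-iut-L2-t9's `thetaStub` for
`C₀ := S.tf` with the morphisms of base-Frobenius type := Def. 4.1 (iv) of the SETTING.  Remaining input:
`Φ(A)` integral for every `A`. [cite: MochizukiEtTh2009, §5 p.322 (PDF p.96)] -/
def thetaStub (hΦ : ∀ A : Dᵒᵖ, IsIntegral (S.tf.Φ.carrier A)) : TemperedFrobenioidStub.{w} S.C D :=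
  S.tf.thetaStub hΦ S.isOfBaseFrobeniusType

/-- The class "of base-Frobenius type" of the stub IS Def. 4.1 (iv) of the setting (definitionally).
[cite: MochizukiEtTh2009, Def 4.1 p.313 (PDF p.87)] -/
theorem thetaStub_isBaseFrobeniusType (hΦ : ∀ A : Dᵒᵖ, IsIntegral (S.tf.Φ.carrier A)) {A B : S.C}
    (α : A ⟶ B) : (S.thetaStub hΦ).IsBaseFrobeniusType α ↔ S.IsOfBaseFrobeniusType α := Iff.rfl

/-- The stub's `PreFrobenioidData` / units / birational units are those of `TemperedFrobenioid.thetaStub`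
(abc-iut-L2-t9, `ThetaFrobenioidOfTempered.lean`; definitionally).
[cite: MochizukiEtTh2009, §5 p.322 (PDF p.96)] -/
theorem thetaStub_eq (hΦ : ∀ A : Dᵒᵖ, IsIntegral (S.tf.Φ.carrier A)) :
    S.thetaStub hΦ = S.tf.thetaStub hΦ S.isOfBaseFrobeniusType := rfl

/-- `O^×(A^birat)` of the stub is `B(A_D)^×` (the units of abc-iut-L2-t3's rational-function monoid).
[cite: MochizukiEtTh2009, Def 3.6 p.303 (PDF p.77)] -/
theorem thetaStub_biratUnits (hΦ : ∀ A : Dᵒᵖ, IsIntegral (S.tf.Φ.carrier A)) (A : S.C) :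
    (S.thetaStub hΦ).biratUnits A = (S.tf.ratFn (op A.base))ˣ := rfl

/-! ### The canonical model setting: clause (e) and clause (i) unfolded -/

variable (Xg : SemiGraphs.TemperedArithmeticGroup.{u₀} K) (tf : TemperedFrobenioid T D VD)
  (hZ : tf.monoidType = MonoidType.Z) (hP : ∀ A : Dᵒᵖ, IsPerfect (tf.Φ.carrier A)) (IG : D → Prop)
  (gS : ∀ A : D, IG A → (Xg.Pi →* Aut A)) (gSs : ∀ (A : D) (h : IG A), Function.Surjective (gS A h))
  (NH : Subgroup (Field.absoluteGaloisGroup K) → tf.category → ℕ+ → Prop) (A₀ : tf.category)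
  (hA₀ : PreFrobenioid.IsFrobeniusTrivial tf.toElem A₀) (hA₀' : IG A₀.base)

/-- For the canonical model setting, Def. 4.1 (iv)(e) of a base-Frobenius-type datum reads
`TemperedFrobenioid.ArisesFromBaseFrobeniusPair` ([FrdI] Def. 2.7 (iii) / Prop. 5.6; definitionally).
[cite: MochizukiEtTh2009, Def 4.1 p.313 (PDF p.87)] -/
theorem cond_e_mkOfModelCanonical {A B : (mkOfModelCanonical Xg tf hZ hP IG gS gSs NH A₀ hA₀ hA₀').C}
    {α : A ⟶ B}
    (d : (mkOfModelCanonical Xg tf hZ hP IG gS gSs NH A₀ hA₀ hA₀').BaseFrobeniusTypeData α) :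
    tf.ArisesFromBaseFrobeniusPair d.G d.α₂ d.α₁ := d.cond_e

/-- Hence a morphism of base-Frobenius type of the canonical model setting lives in a Frobenioid of
pre-model type ([FrdI] Def. 2.7 (iii); cf. Thm. 3.7 (i) "of model type").
[cite: MochizukiEtTh2009, Def 4.1 p.313 (PDF p.87)] -/
theorem isOfPreModelType_of_isOfBaseFrobeniusType
    {A B : (mkOfModelCanonical Xg tf hZ hP IG gS gSs NH A₀ hA₀ hA₀').C} {α : A ⟶ B}
    (h : (mkOfModelCanonical Xg tf hZ hP IG gS gSs NH A₀ hA₀ hA₀').IsOfBaseFrobeniusType α) :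
    PreFrobenioid.IsOfPreModelType tf.toElem := by
  obtain ⟨d⟩ := h
  exact (cond_e_mkOfModelCanonical Xg tf hZ hP IG gS gSs NH A₀ hA₀ hA₀' d).isOfPreModelType

end BiKummerSetting

end Literature.AnabelianGeometry.EtaleTheta

end
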